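import Literature.NumberTheory.EllipticCurves.Kato2004.EulerSystemIsogenyTransport
import Literature.NumberTheory.EllipticCurves.Kato2004.EulerSystemValuesMember
import Literature.NumberTheory.EllipticCurves.IsogenyDualInseparableProofs
import Literature.NumberTheory.EllipticCurves.IsogenyDegreeProofs
import Literature.NumberTheory.EllipticCurves.TateModuleContinuityProofs
import HarnessLib

/-!
# Kato 2004 (Astérisque 295) (8.1.3) / Ex. 13.3 / Thm. 9.7: Kato's Euler system WITH ITS DUAL-EXPONENTIAL VALUES
# (`ZetaBody`) is transported along a `ℚ`-isogeny; consequently the member fact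
# `exists_member_eulerSystem_expStar_values` yields the data at EVERY elliptic curve of the isogeny class
# (member-free, image-free) and implies the irreducible-image fact `exists_eulerSystem_expStar_values`

Topic `NumberTheory/EllipticCurves`, sub-directory `Kato2004` (namespace = path).  Cell `bsd-potss`, seat
`bsd-potss-rkm` (g14), crux M = item stmt-BirchSwinnertonDyer-19196 `ReducibleKatoMember` (K9 / K8-t′).  Companion of
`EulerSystemIsogenyTransport.lean` (the push-forward `φ_*` on `H¹`, `IsEulerSystem.isogenyMap`).

## What is proved

Let `φ : W → W'` be a `ℚ`-isogeny of elliptic curves and `ψ : W' → W` an isogeny with `ψ ∘ φ = [n]`, `n ≠ 0` (the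
dual isogeny, *AEC* III.6.1; tree theorem `Isogeny.exists_dual_comp_eq_deg_smul`).  For a dual-exponential datum
`Λ = (Λ_{k,r})` on the levels `H¹(ℚ(μ_{m(k,r)}), T_pW)` put `Λ''_{k,r} := n⁻¹ · Λ_{k,r} ∘ ψ_*` on
`H¹(ℚ(μ_{m(k,r)}), T_pW')` (written inline; no definition is introduced).  Then (`ZetaBody.isogeny_transport`):

  `ZetaBody W p f ι κ Λ c d a A z x  ⟹  ZetaBody W' p f ι κ Λ'' c d a A (φ_* z) x`

with the SAME newform `f`, embeddings `ι`, constant `κ`, auxiliary data `(c, d, a, A)` and values `x`: (C1) the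
norm relations transport (`IsEulerSystem.isogenyMap`); (C2) unramifiedness transports (`φ_*` commutes with
restriction); (C3a) `Λ''` is `Gal(ℚ(μ_m)/ℚ)`-equivariant (`ψ_*` commutes with the conjugation action, the twisting
operator `1 ⊗ σ_b` is `ℚ`-linear); (C3b) `Λ''` is local at `p` (restriction again); (C4) `Λ''(φ_* z) = n⁻¹ Λ(ψ_* φ_* z)
= n⁻¹ Λ(n z) = Λ(z) = 1 ⊗ x`; (C5) concerns `x` only.  Since `Λ''` does not depend on `(c, d, a, A)`, ONE datum at
`W` gives ONE datum at `W'` (`exists_zetaBody_of_isogeny`), which is the quantifier shape of the two facts.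

Consequences for the cell's named facts (theorems ABOUT the facts, nothing asserted):
* `forall_exists_zetaBody_of_member` — `exists_member_eulerSystem_expStar_values` ⟹ for EVERY elliptic `W/ℚ`,
  every `p`, the newform `f` of `W` and every `ι`: `∃ κ ≠ 0, ∃ Λ, ∀ (c,d,a,A) admissible, ∃ z x, ZetaBody W p f ι κ Λ …`
  (the member `W_K` is no longer displayed: Kato's construction on `V_{ℤ_p}(f)(1) = T_pW_K` reaches `T_pW` along
  `W_K → W`, as print has it — (8.1.3) is stated for `T = V_{O_λ}(f)`, and any stable lattice is reached by an
  isogeny, §8.3 / *AEC* III.7.4);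
* `exists_zetaBody_of_member_of_isIsogenous` — the same at every curve `W''` isogenous to `W`, for the newform of `W`
  (transport `W_K → W → W''`), the form consumed by the cell's shell statements;
* `exists_eulerSystem_expStar_values_of_member` — hence the member fact IMPLIES the irreducible-image fact
  `exists_eulerSystem_expStar_values` (its hypothesis `W[p]` irreducible is idle): lattice `(member) ≥ (irreducible)`.

HONEST FRAMING: no fact is discharged (`exists_member_eulerSystem_expStar_values` is Kato's construction, size XL);
the member-free form is a CONSEQUENCE of the member form, never stronger than print; BSD is not advanced.

## References

* K. Kato, Astérisque 295 (2004): (8.1.3) (p. 180), §8.3 (p. 181), Prop. 8.12 (p. 186), §9.4 and Thm. 9.7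
  (pp. 188–189), §13.1 (13.1.1) and Ex. 13.3 (pp. 224–225). [Kato2004Asterisque]
* K. Rubin, *Euler Systems* (2000), Def. 2.1.1. [Rubin2000]
* J. H. Silverman, *AEC* (2009), Thm. III.6.1 (a), III.7.4. [SilvermanAEC2009]
* Tree: `EulerSystemIsogenyTransport.lean`, `EulerSystemValues.lean` (`ZetaBody`, `exists_eulerSystem_expStar_values`),
  `EulerSystemValuesMember.lean` (`exists_member_eulerSystem_expStar_values`), `IsogenyDualInseparableProofs.lean`,
  `IsogenyDegreeProofs.lean` (`Isogeny.deg_pos_holds`), `TateModuleContinuityProofs.lean` / `TateModuleFreeProofs` /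
  `TateModuleFinite` (the instance binders at the member).
-/

noncomputable section

open scoped NumberField TensorProduct
open CategoryTheory Field IsDedekindDomain CongruenceSubgroup
open Literature.NumberTheory.GaloisRepresentations
open Literature.NumberTheory.EllipticCurves Literature.NumberTheory.EllipticCurves.ModularForms
open Literature.NumberTheory.EllipticCurves.Kato2004
open Literature.NumberTheory.EllipticCurves.Kato2004.EulerSystemValues Rat.HeightOneSpectrum

namespace Literature.NumberTheory.EllipticCurves.Kato2004

/-! ## §1 The transported dual-exponential datum and the transport of `ZetaBody` -/

section Transport

variable {W W' : WeierstrassCurve ℚ} [W.IsElliptic] [W'.IsElliptic] (p : ℕ) [Fact p.Prime]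
  [ContinuousSMul ℤ_[p] (W.tateModule p)] [ContinuousSMul ℤ_[p] (W'.tateModule p)]
  [Module.Free ℤ_[p] (W.tateModule p)] [Module.Finite ℤ_[p] (W.tateModule p)]
  [Module.Free ℤ_[p] (W'.tateModule p)] [Module.Finite ℤ_[p] (W'.tateModule p)]

/-- **An isogeny transports Kato's Euler system together with its dual-exponential values.**  For a
`ℚ`-isogeny `φ : W → W'` of elliptic curves, an isogeny `ψ : W' → W` with `ψ ∘ φ = [n]`, `n ≠ 0`, and data
`(κ, Λ, c, d, a, A, z, x)` with `ZetaBody W p f ι κ Λ c d a A z x`, the pushed-forward classes `φ_* z_{k,r}` with the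
transported datum `Λ'' = n⁻¹ · Λ ∘ ψ_*` and the SAME `(f, ι, κ, c, d, a, A, x)` satisfy `ZetaBody W' p f ι κ Λ'' c d a A
(φ_* z) x`: (C1) `IsEulerSystem.isogenyMap`; (C2)/(C3b) `φ_*`, `ψ_*` commute with restriction; (C3a) `ψ_*`
commutes with the `Gal(ℚ(μ_m)/ℚ)`-action and `1 ⊗ σ_b` is `ℚ`-linear; (C4) `n⁻¹ Λ(ψ_* φ_* z) = n⁻¹ Λ(n z) = 1 ⊗ x`;
(C5) is about `x`.  (Kato (8.1.3) is stated for the lattice `V_{O_λ}(f)`; this is the bookkeeping that moves it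
to any `ℚ`-isogenous lattice.) [cite: Kato2004Asterisque, (8.1.3) (p. 180), Prop. 8.12 (p. 186), §9.4 and Thm. 9.7 (pp. 188–189), §13.1 (13.1.1) and Ex. 13.3 (pp. 224–225)]
[cite: SilvermanAEC2009, Thm. III.6.1 (a) and III.7.4] -/
theorem ZetaBody.isogeny_transport {N : ℕ} (f : CuspForm (Gamma0 N) 2) (ι : (m : ℕ) → (CyclotomicField m ℚ →+* ℂ))
    (κ : ℝ)
    (Λ : ∀ (k : ℕ) (r : Finset (HeightOneSpectrum (𝓞 ℚ))),
      H1 (tateRep W p) (cycSubgroup p k r) →ₗ[ℤ_[p]] ℚ_[p] ⊗[ℚ] CyclotomicField (cycLevel p k r) ℚ)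
    (c d a : ℤ) (A : ℕ)
    (z : ∀ (k : ℕ) (r : (cyclotomicLevelsRat p (badPlaces c d A N)).Ideals),
      H1 (tateRep W p) ((cyclotomicLevelsRat p (badPlaces c d A N)).level k r.1))
    (x : ∀ (k : ℕ) (r : (cyclotomicLevelsRat p (badPlaces c d A N)).Ideals), CyclotomicField (cycLevel p k r.1) ℚ)
    (φ : WeierstrassCurve.Isogeny W W') (ψ : WeierstrassCurve.Isogeny W' W) {n : ℤ} (hn : n ≠ 0)
    (hψφ : ∀ P, ψ (φ P) = n • P) (h : ZetaBody W p f ι κ Λ c d a A z x) :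
    ZetaBody W' p f ι κ (fun k r ↦ ((n : ℚ)⁻¹) • ((Λ k r).comp (isogenyMapH1 p ψ (cycSubgroup p k r)))) c d a A
      (fun k r ↦ isogenyMapH1 p φ ((cyclotomicLevelsRat p (badPlaces c d A N)).level k r.1) (z k r)) x := by
  obtain ⟨h1, h2, h3a, h3b, h4, h5⟩ := h
  refine ⟨IsEulerSystem.isogenyMap p _ φ h1, ?_, ?_, ?_, ?_, h5⟩
  · -- (C2) unramified away from `p`
    intro k r v hv 𝔓 h𝔓
    rw [← isogenyMapH1_resLe, h2 k r v hv 𝔓 h𝔓, map_zero]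
  · -- (C3a) equivariance of `Λ''`
    intro k r σ y
    simp only [LinearMap.smul_apply, LinearMap.coe_comp, Function.comp_apply]
    rw [isogenyMapH1_conjMap, h3a k r σ, map_smul]
  · -- (C3b) `Λ''` is local at `p`
    intro k r y hy
    simp only [LinearMap.smul_apply, LinearMap.coe_comp, Function.comp_apply]
    rw [h3b k r _ fun v hv 𝔓 h𝔓 ↦ ?_, smul_zero]
    rw [← isogenyMapH1_resLe, hy v hv 𝔓 h𝔓, map_zero]
  · -- (C4) the declared coordinate
    intro k r
    have hc := isogenyMapH1_isogenyMapH1_of_comp_eq_zsmul p φ ψ hψφ (cycSubgroup p k r.1) (z k r)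
    change ((n : ℚ)⁻¹) • Λ k r.1 (isogenyMapH1 p ψ (cycSubgroup p k r.1)
      (isogenyMapH1 p φ (cycSubgroup p k r.1) (z k r))) = _
    rw [hc, map_zsmul, h4 k r, ← Int.cast_smul_eq_zsmul ℚ n, smul_smul,
      inv_mul_cancel₀ (Int.cast_ne_zero.mpr hn), one_smul]

/-- **One datum at `W'` for all auxiliary data, from one datum at `W`** (the quantifier shape of
`exists_(member_)eulerSystem_expStar_values`): given an isogeny `φ : W' → W` of elliptic curves over `ℚ` and, at
`W'`, a constant `κ` and ONE datum `Λ'` serving every admissible `(c, d, a, A)`, the transported datum along the dual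
isogeny serves every admissible `(c, d, a, A)` at `W`, with the same `κ`. [cite: Kato2004Asterisque, (8.1.3) (p. 180) and Ex. 13.3 (p. 225)]
[cite: SilvermanAEC2009, Thm. III.6.1 (a)] -/
theorem exists_zetaBody_of_isogeny (φ : WeierstrassCurve.Isogeny W' W) {N : ℕ} (f : CuspForm (Gamma0 N) 2)
    (ι : (m : ℕ) → (CyclotomicField m ℚ →+* ℂ)) (κ : ℝ)
    (Λ' : ∀ (k : ℕ) (r : Finset (HeightOneSpectrum (𝓞 ℚ))),
      H1 (tateRep W' p) (cycSubgroup p k r) →ₗ[ℤ_[p]] ℚ_[p] ⊗[ℚ] CyclotomicField (cycLevel p k r) ℚ)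
    (h : ∀ (c d a : ℤ) (A : ℕ), 0 < A → Int.gcd c (6 * p * A) = 1 → Int.gcd d (6 * p * N) = 1 →
      ∃ (z : ∀ (k : ℕ) (r : (cyclotomicLevelsRat p (badPlaces c d A N)).Ideals),
            H1 (tateRep W' p) ((cyclotomicLevelsRat p (badPlaces c d A N)).level k r.1))
        (x : ∀ (k : ℕ) (r : (cyclotomicLevelsRat p (badPlaces c d A N)).Ideals),
            CyclotomicField (cycLevel p k r.1) ℚ),
        ZetaBody W' p f ι κ Λ' c d a A z x) :
    ∃ Λ : ∀ (k : ℕ) (r : Finset (HeightOneSpectrum (𝓞 ℚ))),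
        H1 (tateRep W p) (cycSubgroup p k r) →ₗ[ℤ_[p]] ℚ_[p] ⊗[ℚ] CyclotomicField (cycLevel p k r) ℚ,
      ∀ (c d a : ℤ) (A : ℕ), 0 < A → Int.gcd c (6 * p * A) = 1 → Int.gcd d (6 * p * N) = 1 →
        ∃ (z : ∀ (k : ℕ) (r : (cyclotomicLevelsRat p (badPlaces c d A N)).Ideals),
              H1 (tateRep W p) ((cyclotomicLevelsRat p (badPlaces c d A N)).level k r.1))
          (x : ∀ (k : ℕ) (r : (cyclotomicLevelsRat p (badPlaces c d A N)).Ideals),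
              CyclotomicField (cycLevel p k r.1) ℚ),
          ZetaBody W p f ι κ Λ c d a A z x := by
  obtain ⟨ψ, hψ⟩ := φ.exists_dual_comp_eq_deg_smul
  have hn : (φ.deg : ℤ) ≠ 0 := by exact_mod_cast (WeierstrassCurve.Isogeny.deg_pos_holds φ).ne'
  refine ⟨fun k r ↦ (((φ.deg : ℤ) : ℚ)⁻¹) • ((Λ' k r).comp (isogenyMapH1 p ψ (cycSubgroup p k r))),
    fun c d a A hA hc hd ↦ ?_⟩
  obtain ⟨z, x, hz⟩ := h c d a A hA hc hd
  exact ⟨_, x, ZetaBody.isogeny_transport p f ι κ Λ' c d a A z x φ ψ hn hψ hz⟩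

end Transport

/-! ## §2 Consequences for the named facts: the member fact is member-free and implies the irreducible fact -/

/-- **Kato's Euler system with its dual-exponential values exists on `T_pW` for EVERY elliptic curve `W/ℚ`**
(from the member fact `exists_member_eulerSystem_expStar_values`): for every elliptic `W/ℚ`, every prime `p`, the
newform `f` of `W` and every family of embeddings `ι`, there are ONE `κ ≠ 0` and ONE datum `Λ` such that for all
admissible `(c, d, a, A)` there are classes `z` and values `x` with `ZetaBody W p f ι κ Λ c d a A z x` — the member
`W_K` of the fact and its isogeny `W_K → W` (symmetry of isogeny for elliptic curves, `IsIsogenous.symm_of_isElliptic`)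
transport the data (`exists_zetaBody_of_isogeny`); the instance binders at `W_K` are the tree theorems
`TateModule.continuousSMul_padicInt`, `module_free/finite_tateModule_holds`.  A consequence of the member fact,
never stronger than print ((8.1.3) for `T = V_{ℤ_p}(f)(1)` and §8.3: every stable lattice is `ℚ`-isogenous to it).
[cite: Kato2004Asterisque, (8.1.3) (p. 180), §8.3 (p. 181), Ex. 13.3 (p. 225), Thm. 9.7 (p. 189)]
[cite: SilvermanAEC2009, Thm. III.6.1 (a) and III.7.4] -/
theorem forall_exists_zetaBody_of_member (h : exists_member_eulerSystem_expStar_values)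
    (W : WeierstrassCurve ℚ) [W.IsElliptic] (p : ℕ) [Fact p.Prime] [ContinuousSMul ℤ_[p] (W.tateModule p)]
    [Module.Free ℤ_[p] (W.tateModule p)] [Module.Finite ℤ_[p] (W.tateModule p)]
    {N : ℕ} [NeZero N] (f : CuspForm (Gamma0 N) 2) (hf : IsNewformOf W f)
    (ι : (m : ℕ) → (CyclotomicField m ℚ →+* ℂ)) :
    ∃ κ : ℝ, κ ≠ 0 ∧
    ∃ Λ : ∀ (k : ℕ) (r : Finset (HeightOneSpectrum (𝓞 ℚ))),
        H1 (tateRep W p) (cycSubgroup p k r) →ₗ[ℤ_[p]] ℚ_[p] ⊗[ℚ] CyclotomicField (cycLevel p k r) ℚ,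
    ∀ (c d a : ℤ) (A : ℕ), 0 < A → Int.gcd c (6 * p * A) = 1 → Int.gcd d (6 * p * N) = 1 →
      ∃ (z : ∀ (k : ℕ) (r : (cyclotomicLevelsRat p (badPlaces c d A N)).Ideals),
            H1 (tateRep W p) ((cyclotomicLevelsRat p (badPlaces c d A N)).level k r.1))
        (x : ∀ (k : ℕ) (r : (cyclotomicLevelsRat p (badPlaces c d A N)).Ideals),
            CyclotomicField (cycLevel p k r.1) ℚ),
        ZetaBody W p f ι κ Λ c d a A z x := by
  obtain ⟨W', hW'e, _, hiso, hrest⟩ := h W p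
  haveI := hW'e
  haveI : ContinuousSMul ℤ_[p] (W'.tateModule p) := TateModule.continuousSMul_padicInt
  haveI : Module.Free ℤ_[p] (W'.tateModule p) := W'.module_free_tateModule_holds p
  haveI : Module.Finite ℤ_[p] (W'.tateModule p) := W'.module_finite_tateModule_holds p
  obtain ⟨κ, hκ, Λ', hΛ'⟩ := hrest f hf ι
  obtain ⟨φ⟩ := hiso.symm_of_isElliptic
  obtain ⟨Λ, hΛ⟩ := exists_zetaBody_of_isogeny p φ f ι κ Λ' hΛ'
  exact ⟨κ, hκ, Λ, hΛ⟩

/-- **Kato's Euler system with values exists on `T_pW''` for every curve `W''` `ℚ`-ISOGENOUS to `W`, for the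
newform `f` of `W`** (from the member fact): the data at the member `W_K` of `W` are transported along
`W_K → W → W''` (two isogenies; no composition of isogenies is needed).  This is the form consumed by the
cell's «shell» statements, whose inner quantifier is `IsNewformOf W f` for the ORIGINAL curve `W` while the
classes live on a member `W''`. [cite: Kato2004Asterisque, (8.1.3) (p. 180), §8.3 (p. 181), Ex. 13.3 (p. 225), Thm. 9.7 (p. 189)]
[cite: SilvermanAEC2009, Thm. III.6.1 (a) and III.7.4] -/
theorem exists_zetaBody_of_member_of_isIsogenous (h : exists_member_eulerSystem_expStar_values)
    {W W'' : WeierstrassCurve ℚ} [W.IsElliptic] [W''.IsElliptic] (hWW'' : WeierstrassCurve.IsIsogenous W W'')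
    (p : ℕ) [Fact p.Prime] [ContinuousSMul ℤ_[p] (W''.tateModule p)] [Module.Free ℤ_[p] (W''.tateModule p)]
    [Module.Finite ℤ_[p] (W''.tateModule p)]
    {N : ℕ} [NeZero N] (f : CuspForm (Gamma0 N) 2) (hf : IsNewformOf W f)
    (ι : (m : ℕ) → (CyclotomicField m ℚ →+* ℂ)) :
    ∃ κ : ℝ, κ ≠ 0 ∧
    ∃ Λ : ∀ (k : ℕ) (r : Finset (HeightOneSpectrum (𝓞 ℚ))),
        H1 (tateRep W'' p) (cycSubgroup p k r) →ₗ[ℤ_[p]] ℚ_[p] ⊗[ℚ] CyclotomicField (cycLevel p k r) ℚ,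
    ∀ (c d a : ℤ) (A : ℕ), 0 < A → Int.gcd c (6 * p * A) = 1 → Int.gcd d (6 * p * N) = 1 →
      ∃ (z : ∀ (k : ℕ) (r : (cyclotomicLevelsRat p (badPlaces c d A N)).Ideals),
            H1 (tateRep W'' p) ((cyclotomicLevelsRat p (badPlaces c d A N)).level k r.1))
        (x : ∀ (k : ℕ) (r : (cyclotomicLevelsRat p (badPlaces c d A N)).Ideals),
            CyclotomicField (cycLevel p k r.1) ℚ),
        ZetaBody W'' p f ι κ Λ c d a A z x := by
  obtain ⟨W', hW'e, _, hiso, hrest⟩ := h W p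
  haveI := hW'e
  haveI : ContinuousSMul ℤ_[p] (W'.tateModule p) := TateModule.continuousSMul_padicInt
  haveI : Module.Free ℤ_[p] (W'.tateModule p) := W'.module_free_tateModule_holds p
  haveI : Module.Finite ℤ_[p] (W'.tateModule p) := W'.module_finite_tateModule_holds p
  haveI : ContinuousSMul ℤ_[p] (W.tateModule p) := TateModule.continuousSMul_padicInt
  haveI : Module.Free ℤ_[p] (W.tateModule p) := W.module_free_tateModule_holds p
  haveI : Module.Finite ℤ_[p] (W.tateModule p) := W.module_finite_tateModule_holds p
  obtain ⟨κ, hκ, Λ', hΛ'⟩ := hrest f hf ι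
  obtain ⟨φ₁⟩ := hiso.symm_of_isElliptic
  obtain ⟨φ₂⟩ := hWW''
  obtain ⟨Λ₁, hΛ₁⟩ := exists_zetaBody_of_isogeny p φ₁ f ι κ Λ' hΛ'
  obtain ⟨Λ₂, hΛ₂⟩ := exists_zetaBody_of_isogeny p φ₂ f ι κ Λ₁ hΛ₁
  exact ⟨κ, hκ, Λ₂, hΛ₂⟩

/-- **The member fact implies the irreducible-image fact**: `exists_member_eulerSystem_expStar_values →
exists_eulerSystem_expStar_values` (the hypothesis "`W[p]` irreducible" of the latter is idle once the data
are known at every member).  Lattice word for the two transcriptions of Kato (8.1.3)/Ex. 13.3/Thm. 9.7: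
(member) ≥ (irreducible). [cite: Kato2004Asterisque, (8.1.3) (p. 180), Ex. 13.3 (p. 225), Thm. 9.7 (p. 189)] -/
theorem exists_eulerSystem_expStar_values_of_member (h : exists_member_eulerSystem_expStar_values) :
    exists_eulerSystem_expStar_values := by
  intro W _ p _ _ _ _ _ N _ f hf ι
  exact forall_exists_zetaBody_of_member h W p f hf ι

end Literature.NumberTheory.EllipticCurves.Kato2004

end
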